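import Literature.Probability.RandomPlanarGeometry.SimpleCurves
import HarnessLib

/-!
# Rohde–Schramm one level down: a curve whose future after every first hitting time avoids its
# past is flat (hence its class is simple)

Helper file for the crux `SimpleSubseqLimits` (stmt-CriticalPhenomena-4982; decl
`Summit.CriticalPhenomena.SAWScalingLimit.Theses.SAWLoopFugacityFlow.SimpleSubseqLimits`), line
lead c2 (2026-08-16).  It supplies the DETERMINISTIC CLOSING LEMMA of every line that feeds the
ORDER half of the crux through the exact domain Markov property of the critical SAW at FIRST
HITTING TIMES (the slit-restriction card `Ideas/slit-continuous-restriction.md`, and any G-type line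
charging first entrances): Rohde–Schramm's argument that SLE_κ, `κ ≤ 4`, is a simple curve
(Ann. of Math. 161 (2005), proof of Thm. 6.1: "for every rational `t`, `γ[t, ∞) ∩ (ℝ ∪ K_t) = {γ t}`,
hence `γ(s) = γ(u)` forces `γ` to be constant on `[s, u]`") transplanted from deterministic
rational times — which do not exist on the quotient `CurveClass` — to the COUNTABLE family of
first hitting times of closed balls with centres in a dense set and rational radii, which are
functionals of the curve available on the lattice (first entrance of the walk into a ball) and
stopping times for the domain Markov property.

Main results (namespace `…Theorems.SimpleSubseqLimits.FirstHitFlat`):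

* `image_subset_of_apply_eq` — if the future after every first hit of a set of the family `𝒞`
  avoids the past strictly before it, then the loop `γ [p, q]` of every coincidence `γ p = γ q`
  stays inside the past range `γ [0, p]`;
* `isFlat_of_firstHit_avoids` — under the same hypothesis `γ` is FLAT (`Curve.IsFlat`: equal
  values only across intervals of constancy); the proof is a two-step descent on first-visit
  times, no density-in-time hypothesis is needed (contrast `simple_of_dense_pastFuture` of the
  slit-restriction card, FALSE as typed — Disproof §14 — and true only with a dense set of good
  TIMES, which first hitting times do not provide during a retrace);
* `mk_mem_simple_of_firstHit_avoids` — hence, if moreover `γ 0 ≠ γ 1`, the class of `γ` is simple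
  (`Curve.exists_isSimple_of_isFlat`: monotone–light factorisation);
* `isFlat_of_firstHit_closedBall` / `mk_mem_simple_of_firstHit_closedBall` — the instance with
  `𝒞` = closed balls with centres in a dense set `S` and positive rational radii (countable when
  `S` is), the form consumed by a limit passage;
* `IsSimple.firstHit_avoids` — the hypothesis holds for every injective curve (no strength wasted).

No probability here; the lattice input that would feed the hypothesis `ν`-a.s. ("after its first
entrance into `B̄(q, r)` the critical SAW does not come `ε`-close to its earlier past at distance
`≥ ρ` from the entrance point, with probability `→ 0` as `ε → 0`, eventually in `δ`") is the
first-hit (kiss-type) typing of the crux's ORDER residual; see the lead's cycle report.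
-/

noncomputable section

open Set Topology Metric
open scoped unitInterval

namespace Summit.CriticalPhenomena.SAWScalingLimit.Theorems.SimpleSubseqLimits.FirstHitFlat

open Literature.Probability.RandomPlanarGeometry

variable {E : Type*}

section Topological

variable [TopologicalSpace E]

/-- **First hitting times exist**: a closed set met by the curve is met at a least parameter,
before which it is not met (compactness of `[0, 1]`). (Rohde–Schramm 2005, proof of Thm. 6.1,
with hitting times for rational times.) [cite: RohdeSchramm2005, Thm. 6.1] -/
theorem exists_firstHit (γ : Curve E) {C : Set E} (hC : IsClosed C) {t₀ : I} (ht₀ : γ t₀ ∈ C) :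
    ∃ t : I, t ≤ t₀ ∧ γ t ∈ C ∧ ∀ v : I, v < t → γ v ∉ C := by
  have hcl : IsClosed (γ ⁻¹' C) := hC.preimage γ.continuous
  obtain ⟨t, htC, hleast⟩ := hcl.isCompact.exists_isLeast ⟨t₀, ht₀⟩
  exact ⟨t, hleast ht₀, htC, fun v hv hvC => absurd (hleast hvC) (not_le.2 hv)⟩

/-- **The loop of a coincidence stays in the past range.** Let `𝒞` be a family of closed sets
which separates points of the curve from compact pieces of its past (`hsep`: a value `γ t` not
taken on `[0, s]` lies in some `C ∈ 𝒞` missed on `[0, s]`), and suppose that after the FIRST hit of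
every `C ∈ 𝒞` the curve never returns to a value taken strictly before that hit (`havoid`). Then
for every coincidence `γ p = γ q`, every value `γ t₀`, `t₀ ≤ q`, was already taken on `[0, p]`
(trivially so if `t₀ ≤ p`): otherwise the first hit `t` of the separating set lies in `(p, t₀]`
and `γ q = γ p` is a return after `t` to a value taken before `t`. (Rohde–Schramm 2005, proof of Thm. 6.1, first
step.) [cite: RohdeSchramm2005, Thm. 6.1] -/
theorem image_subset_of_apply_eq (γ : Curve E) (𝒞 : Set (Set E))
    (hclosed : ∀ C ∈ 𝒞, IsClosed C)
    (hsep : ∀ s t : I, γ t ∉ γ '' Iic s → ∃ C ∈ 𝒞, γ t ∈ C ∧ ∀ v : I, v ≤ s → γ v ∉ C)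
    (havoid : ∀ C ∈ 𝒞, ∀ t : I, γ t ∈ C → (∀ v : I, v < t → γ v ∉ C) →
      ∀ v u : I, v < t → t ≤ u → γ u ≠ γ v)
    {p q : I} (heq : γ p = γ q) {t₀ : I} (htq : t₀ ≤ q) :
    γ t₀ ∈ γ '' Iic p := by
  by_contra hnot
  obtain ⟨C, hC, ht₀C, hpast⟩ := hsep p t₀ hnot
  obtain ⟨t, htt₀, htC, hfirst⟩ := exists_firstHit γ (hclosed C hC) ht₀C
  have hpt' : p < t := lt_of_not_ge fun h => hpast t h htC
  exact havoid C hC t htC hfirst p q hpt' (htt₀.trans htq) heq.symm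

/-- **First-hit avoidance ⇒ flat** (Rohde–Schramm one level down). Under the hypotheses of
`image_subset_of_apply_eq` (points are closed in `E`), the curve is flat: if `γ s = γ t` with
`s ≤ u ≤ t` then `γ u = γ s`. Proof: let `s₁` be the FIRST visit of the value `γ s`; if
`γ u ≠ γ s`, the loop lemma at the coincidence `(s₁, t)` gives `γ u = γ v` with `v < s₁`, and the
loop lemma at the coincidence `(v, u)` puts `γ s` among the values taken on `[0, v]`, i.e. before
`s₁` — contradicting the choice of `s₁`. No density of good times is assumed. (Rohde–Schramm 2005,
proof of Thm. 6.1.) [cite: RohdeSchramm2005, Thm. 6.1] -/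
theorem isFlat_of_firstHit_avoids [T1Space E] (γ : Curve E) (𝒞 : Set (Set E))
    (hclosed : ∀ C ∈ 𝒞, IsClosed C)
    (hsep : ∀ s t : I, γ t ∉ γ '' Iic s → ∃ C ∈ 𝒞, γ t ∈ C ∧ ∀ v : I, v ≤ s → γ v ∉ C)
    (havoid : ∀ C ∈ 𝒞, ∀ t : I, γ t ∈ C → (∀ v : I, v < t → γ v ∉ C) →
      ∀ v u : I, v < t → t ≤ u → γ u ≠ γ v) :
    γ.IsFlat := by
  intro s u t hsu hut hst
  -- the first visit `s₁` of the value `γ s`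
  have hcl : IsClosed (γ ⁻¹' {γ s}) := isClosed_singleton.preimage γ.continuous
  obtain ⟨s₁, hs₁x, hleast⟩ := hcl.isCompact.exists_isLeast ⟨s, rfl⟩
  have hs₁x' : γ s₁ = γ s := hs₁x
  by_contra hne
  -- loop lemma at the coincidence `(s₁, t)`, evaluated at `u`
  obtain ⟨v, hv, hvu⟩ := image_subset_of_apply_eq γ 𝒞 hclosed hsep havoid (hs₁x'.trans hst) hut
  have hvs₁ : v < s₁ := by
    refine lt_of_le_of_ne hv fun h => hne ?_
    rw [← hvu, h, hs₁x']
  -- loop lemma at the coincidence `(v, u)`, evaluated at `s`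
  obtain ⟨w, hw, hws⟩ := image_subset_of_apply_eq γ 𝒞 hclosed hsep havoid hvu hsu
  have hs₁w : s₁ ≤ w := hleast (show γ w ∈ ({γ s} : Set E) from hws)
  exact absurd (hs₁w.trans hw) (not_le.2 hvs₁)

/-- **No strength wasted**: an injective curve satisfies the first-hit avoidance hypothesis for
EVERY family (its future never returns to any earlier value at all). [folklore] -/
theorem IsSimple.firstHit_avoids {γ : Curve E} (hγ : γ.IsSimple) (C : Set E) (t : I)
    (_htC : γ t ∈ C) (_hfirst : ∀ v : I, v < t → γ v ∉ C) (v u : I) (hvt : v < t) (htu : t ≤ u) :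
    γ u ≠ γ v :=
  fun h => absurd (hγ h) (ne_of_gt (hvt.trans_le htu))

end Topological

section Metric

variable [MetricSpace E]

/-- **First-hit avoidance ⇒ simple class.** Under the hypotheses of `isFlat_of_firstHit_avoids`,
a curve with distinct endpoints is at reparametrisation distance `0` from an injective curve
(monotone–light factorisation of flat curves, `Curve.exists_isSimple_of_isFlat`), so its class is
simple. (Rohde–Schramm 2005, Thm. 6.1, closing step, on the quotient `CurveClass`.)
[cite: RohdeSchramm2005, Thm. 6.1] -/
theorem mk_mem_simple_of_firstHit_avoids (γ : Curve E) (𝒞 : Set (Set E))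
    (hclosed : ∀ C ∈ 𝒞, IsClosed C)
    (hsep : ∀ s t : I, γ t ∉ γ '' Iic s → ∃ C ∈ 𝒞, γ t ∈ C ∧ ∀ v : I, v ≤ s → γ v ∉ C)
    (havoid : ∀ C ∈ 𝒞, ∀ t : I, γ t ∈ C → (∀ v : I, v < t → γ v ∉ C) →
      ∀ v u : I, v < t → t ≤ u → γ u ≠ γ v)
    (h01 : γ 0 ≠ γ 1) : CurveClass.mk γ ∈ CurveClass.simple := by
  obtain ⟨γ₀, hγ₀, -, hd⟩ :=
    Curve.exists_isSimple_of_isFlat (isFlat_of_firstHit_avoids γ 𝒞 hclosed hsep havoid) h01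
  refine ⟨γ₀, hγ₀, ?_⟩
  rw [CurveClass.mk_eq_mk_iff_dist_eq_zero, dist_comm]
  exact hd

/-- **Closed balls with dense centres and rational radii separate** a value of the curve from any
compact piece of its past missing it: the complement of the compact past is open, a dense centre
within a third of the margin and a rational radius between one and two thirds of it do.
[folklore] -/
theorem exists_closedBall_separating (γ : Curve E) {S : Set E} (hS : Dense S) (s t : I)
    (ht : γ t ∉ γ '' Iic s) :
    ∃ q ∈ S, ∃ r : ℚ, 0 < r ∧ γ t ∈ closedBall q (r : ℝ) ∧
      ∀ v : I, v ≤ s → γ v ∉ closedBall q (r : ℝ) := by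
  have hK : IsCompact (γ '' Iic s) := isClosed_Iic.isCompact.image γ.continuous
  obtain ⟨ε, hε, hball⟩ := Metric.isOpen_iff.1 hK.isClosed.isOpen_compl (γ t) ht
  obtain ⟨q, hqS, hq⟩ := hS.exists_dist_lt (γ t) (by positivity : (0 : ℝ) < ε / 3)
  obtain ⟨r, hr₁, hr₂⟩ := exists_rat_btwn (by linarith : ε / 3 < 2 * ε / 3)
  have hr0 : (0 : ℝ) < r := by linarith
  refine ⟨q, hqS, r, by exact_mod_cast hr0, ?_, fun v hv hvB => ?_⟩
  · rw [mem_closedBall]; linarith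
  · have hvball : γ v ∈ ball (γ t) ε := by
      rw [mem_closedBall] at hvB
      rw [mem_ball]
      calc dist (γ v) (γ t) ≤ dist (γ v) q + dist q (γ t) := dist_triangle _ _ _
        _ < ε := by rw [dist_comm q]; linarith
    exact hball hvball ⟨v, hv, rfl⟩

/-- **First-hit avoidance over closed balls ⇒ flat.** If after its FIRST entrance into each closed
ball `B̄(q, r)` (`q` in a dense set `S`, `r` positive rational) the curve never returns to a value
taken strictly before that entrance, then the curve is flat. The family is countable when `S` is
(e.g. `ℚ + iℚ ⊆ ℂ`), which is the form a limit passage delivers `ν`-almost surely.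
(Rohde–Schramm 2005, proof of Thm. 6.1, with first hitting times of balls for rational times.)
[cite: RohdeSchramm2005, Thm. 6.1] -/
theorem isFlat_of_firstHit_closedBall (γ : Curve E) {S : Set E} (hS : Dense S)
    (havoid : ∀ q ∈ S, ∀ r : ℚ, 0 < r → ∀ t : I, γ t ∈ closedBall q (r : ℝ) →
      (∀ v : I, v < t → γ v ∉ closedBall q (r : ℝ)) → ∀ v u : I, v < t → t ≤ u → γ u ≠ γ v) :
    γ.IsFlat := by
  refine isFlat_of_firstHit_avoids γ
    {C | ∃ q ∈ S, ∃ r : ℚ, 0 < r ∧ C = closedBall q (r : ℝ)} ?_ ?_ ?_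
  · rintro C ⟨q, -, r, -, rfl⟩
    exact isClosed_closedBall
  · intro s t ht
    obtain ⟨q, hqS, r, hr, htB, hpast⟩ := exists_closedBall_separating γ hS s t ht
    exact ⟨_, ⟨q, hqS, r, hr, rfl⟩, htB, hpast⟩
  · rintro C ⟨q, hqS, r, hr, rfl⟩
    exact havoid q hqS r hr

/-- **First-hit avoidance over closed balls ⇒ simple class** (distinct endpoints).
(Rohde–Schramm 2005, Thm. 6.1, on the quotient `CurveClass`.) [cite: RohdeSchramm2005, Thm. 6.1] -/
theorem mk_mem_simple_of_firstHit_closedBall (γ : Curve E) {S : Set E} (hS : Dense S)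
    (havoid : ∀ q ∈ S, ∀ r : ℚ, 0 < r → ∀ t : I, γ t ∈ closedBall q (r : ℝ) →
      (∀ v : I, v < t → γ v ∉ closedBall q (r : ℝ)) → ∀ v u : I, v < t → t ≤ u → γ u ≠ γ v)
    (h01 : γ 0 ≠ γ 1) : CurveClass.mk γ ∈ CurveClass.simple := by
  obtain ⟨γ₀, hγ₀, -, hd⟩ :=
    Curve.exists_isSimple_of_isFlat (isFlat_of_firstHit_closedBall γ hS havoid) h01
  refine ⟨γ₀, hγ₀, ?_⟩
  rw [CurveClass.mk_eq_mk_iff_dist_eq_zero, dist_comm]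
  exact hd

end Metric

/-- **Registered form (`E = ℂ`) for the crux item stmt-CriticalPhenomena-4982**: a planar curve
with distinct endpoints whose future after its first entrance into each closed ball `B̄(q, r)`
(`q` in a dense set, `r` positive rational) never returns to a value taken strictly before that
entrance has a SIMPLE class. (Rohde–Schramm 2005, Thm. 6.1, one level down, on `CurveClass ℂ`.)
[cite: RohdeSchramm2005, Thm. 6.1] -/
theorem firstHit_closedBall_simple : ∀ (γ : Curve ℂ) (S : Set ℂ), Dense S → (∀ q ∈ S, ∀ r : ℚ, 0 < r → ∀ t : I, γ t ∈ closedBall q (r : ℝ) → (∀ v : I, v < t → γ v ∉ closedBall q (r : ℝ)) → ∀ v u : I, v < t → t ≤ u → γ u ≠ γ v) → γ 0 ≠ γ 1 → CurveClass.mk γ ∈ CurveClass.simple :=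
  fun γ _S hS havoid h01 => mk_mem_simple_of_firstHit_closedBall γ hS havoid h01

end Summit.CriticalPhenomena.SAWScalingLimit.Theorems.SimpleSubseqLimits.FirstHitFlat

end
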